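import Mathlib
import HarnessLib
import Literature.Analysis.FluidPDE.ClassicalSolution
import Literature.Analysis.FluidPDE.SuitableWeak
import Literature.Analysis.FluidPDE.VectorCalculus
import Literature.Analysis.FluidPDE.TaoLocalisation
import Literature.Analysis.FluidPDE.TaoLocalisationHolds
import Literature.Analysis.FluidPDE.TaoLocalisationProofs
import Literature.Analysis.FluidPDE.TaoEnstrophyLocalisation

/-!
# Shelf 1574, line `lamb_budget`: the FAST-SET BUDGET (stub 5, `FastSetBudget`)

Helper file (`--supports stmt-NavierStokesRegularity-1574 --as helper`; director KEY-NS #114 (2)). Stub 5 of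
ns-idea-9's LINE 7 `Cruxes/EnstrophyQuarterLaw/Lines/lamb_budget.lean` ("provable, S/M — measure × sup on the
fast set"), with the line's Cruxes-local predicates (`fastSet`, `intenseLambBudget`, `IntenseLambLaw`,
`VolumeSparse`, `VorticityTypeI`) UNFOLDED VERBATIM: for one maximal classical Leray–Hopf solution from a
rapidly decaying datum, the sup-rate Type-I bounds `|u| ≤ C/√(T−s)`, `|curl u| ≤ C_ω/(T−s)` near `T` and
volume sparseness of the fast set `F_{c₀}(s) = {|u(s)| > c₀√(ν/(T−s))}`, `|F_{c₀}(s)| ≤ N(√(ν(T−s)))³`, give the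
super-threshold Lamb-budget quarter law
`𝔏_{c₀}(t) = ∫₀ᵗ ∫_{F_{c₀}(s)} |curl u × u|² ≤ K/√(T−t)` on `[0, T)`.

PROOF. `|ω × u|² ≤ |ω|²|u|²`. LATE times (`s` in the window where both rates hold):
`∫_F |ω×u|² ≤ |F(s)| · C_ω²C²(T−s)⁻³ ≤ A (√(T−s))⁻³`, `A = max(N,0) (√ν)³ C_ω² C²`. EARLY times (`s ≤ S`,
`S < T`): Tao's class on the closed sub-slab `[0, S]` (`tao2011_hasBoundedSobolevNormsOn_holds`: `|u| ≤ V` by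
`H² ⊂ L^∞`, `∫|∇u(s)|² ≤ C₁`) and `|curl v| ≤ κ‖∇v‖` give `∫_F |ω×u|² ≤ V²κ²C₁ =: E₁`. Hence the
integrand is `≤ E₁ + A(√(T−s))⁻³` on `(0, t)` and `∫₀ᵗ (T−s)^{−3/2} ds ≤ 2/√(T−t)`
(`lintegral_Ioo_inv_sqrt_cube_le`, FTC), so `𝔏 ≤ E₁T + 2A/√(T−t) ≤ (E₁T√T + 2A)/√(T−t)`.

HONEST FRAMING: bookkeeping about ONE hypothetical Type-I blow-up; nothing here bears on the regularity
problem; `EnstrophyQuarterLaw` (1574), the Type-I wall (0056) and `VolumeSparsenessLaw` stay OPEN. No summit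
statement is proved.
-/

noncomputable section

-- the summit-side namespace repeats a component by design (D-0017)
set_option linter.dupNamespace false

namespace Summit.NavierStokesRegularity.NavierStokesRegularity.Theorems.EnstrophyQuarterLaw.LambBudget

open Set MeasureTheory Function Metric Filter Topology
open scoped ENNReal NNReal
open Literature.Analysis.FluidPDE

/-! ### Elementary tools -/

/-- `‖a × b‖ₑ² ≤ ‖a‖ₑ² ‖b‖ₑ²` (`‖a × b‖ = ‖a‖‖b‖ sin∠(a,b)`). [folklore] -/
theorem enorm_cross_sq_le (a b : EuclideanSpace ℝ (Fin 3)) :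
    ‖cross a b‖ₑ ^ 2 ≤ ‖a‖ₑ ^ 2 * ‖b‖ₑ ^ 2 := by
  have h : ‖cross a b‖ ≤ ‖a‖ * ‖b‖ := by
    rw [norm_cross]
    exact mul_le_of_le_one_right (by positivity) (Real.sin_le_one _)
  calc ‖cross a b‖ₑ ^ 2 = ENNReal.ofReal ‖cross a b‖ ^ 2 := by rw [ofReal_norm]
    _ ≤ ENNReal.ofReal (‖a‖ * ‖b‖) ^ 2 := by gcongr
    _ = ‖a‖ₑ ^ 2 * ‖b‖ₑ ^ 2 := by
        rw [ENNReal.ofReal_mul (norm_nonneg _), ofReal_norm, ofReal_norm, mul_pow]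

/-- A real bound `‖v‖ ≤ c` in the squared extended form `‖v‖ₑ² ≤ ofReal (c²)`. [folklore] -/
theorem enorm_sq_le_ofReal_sq {v : EuclideanSpace ℝ (Fin 3)} {c : ℝ} (h : ‖v‖ ≤ c) :
    ‖v‖ₑ ^ 2 ≤ ENNReal.ofReal (c ^ 2) := by
  rw [← ofReal_norm, ← ENNReal.ofReal_pow (norm_nonneg _)]
  exact ENNReal.ofReal_le_ofReal (pow_le_pow_left₀ (norm_nonneg _) h 2)

/-- `∫₀ᵗ (√(T−s))⁻³ ds ≤ 2/√(T−t)` for `0 ≤ t < T` (the antiderivative `2(√(T−s))⁻¹`). [folklore] -/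
theorem lintegral_Ioo_inv_sqrt_cube_le {T t : ℝ} (ht0 : 0 ≤ t) (htT : t < T) :
    ∫⁻ s in Ioo 0 t, ENNReal.ofReal ((Real.sqrt (T - s))⁻¹ ^ 3) ≤
      ENNReal.ofReal (2 / Real.sqrt (T - t)) := by
  have hpos : ∀ s ∈ uIcc 0 t, 0 < T - s := by
    intro s hs
    rw [uIcc_of_le ht0] at hs
    linarith [hs.2]
  have hderiv : ∀ s ∈ uIcc 0 t,
      HasDerivAt (fun s => 2 * (Real.sqrt (T - s))⁻¹) ((Real.sqrt (T - s))⁻¹ ^ 3) s := by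
    intro s hs
    have hTs := hpos s hs
    have hsq : Real.sqrt (T - s) ≠ 0 := (Real.sqrt_pos.2 hTs).ne'
    have h1 : HasDerivAt (fun s => T - s) (-1) s := by
      simpa using (hasDerivAt_id s).const_sub T
    have h2 : HasDerivAt (fun s => Real.sqrt (T - s)) (-1 / (2 * Real.sqrt (T - s))) s :=
      h1.sqrt hTs.ne'
    have h3 := (h2.inv hsq).const_mul 2
    have key : ∀ b : ℝ, b ≠ 0 → 2 * (-(-1 / (2 * b)) / b ^ 2) = b⁻¹ ^ 3 := by
      intro b hb
      field_simp
    exact h3.congr_deriv (key _ hsq)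
  have hcont : ContinuousOn (fun s => (Real.sqrt (T - s))⁻¹ ^ 3) (uIcc 0 t) := by
    refine ContinuousOn.pow (ContinuousOn.inv₀ ?_ fun s hs => (Real.sqrt_pos.2 (hpos s hs)).ne') 3
    exact (Real.continuous_sqrt.comp (continuous_const.sub continuous_id)).continuousOn
  have hint : IntervalIntegrable (fun s => (Real.sqrt (T - s))⁻¹ ^ 3) volume 0 t :=
    hcont.intervalIntegrable
  have hFTC := intervalIntegral.integral_eq_sub_of_hasDerivAt hderiv hint
  have hnn : ∀ s, 0 ≤ (Real.sqrt (T - s))⁻¹ ^ 3 := fun s => by positivity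
  have hintegrable : Integrable (fun s => (Real.sqrt (T - s))⁻¹ ^ 3) (volume.restrict (Ioo 0 t)) := by
    have h1 : IntegrableOn (fun s => (Real.sqrt (T - s))⁻¹ ^ 3) (Icc 0 t) volume := by
      rw [← uIcc_of_le ht0]
      exact hcont.integrableOn_compact isCompact_uIcc
    exact h1.mono_set Ioo_subset_Icc_self
  rw [← ofReal_integral_eq_lintegral_ofReal hintegrable (ae_of_all _ hnn)]
  have hIoo : ∫ s in Ioo 0 t, (Real.sqrt (T - s))⁻¹ ^ 3 =
      ∫ s in (0 : ℝ)..t, (Real.sqrt (T - s))⁻¹ ^ 3 := by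
    rw [intervalIntegral.integral_of_le ht0, integral_Ioc_eq_integral_Ioo]
  rw [hIoo, hFTC]
  refine ENNReal.ofReal_le_ofReal ?_
  have h0 : 0 ≤ 2 * (Real.sqrt (T - 0))⁻¹ := by positivity
  rw [div_eq_mul_inv]
  linarith

/-! ### Stub 5 of `Lines/lamb_budget.lean`: the fast-set budget -/

/-- **`FastSetBudget` of `Lines/lamb_budget.lean` (stub 5, signature VERBATIM with the Cruxes-local
predicates unfolded).** For every threshold `c₀ > 0` and every maximal classical Leray–Hopf solution from a
rapidly decaying datum: the Type-I rate for `u`, the Type-I rate `|curl u| ≤ C_ω/(T−t)` for the vorticity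
near `T`, and volume sparseness of the fast set `|{|u(s)| > c₀√(ν/(T−s))}| ≤ N(√(ν(T−s)))³` on `[0,T)` imply
the super-threshold Lamb-budget law `∫₀ᵗ∫_{F(s)} |curl u × u|² ≤ K/√(T−t)` on `[0, T)`
(measure × sup on the fast set late, Tao-class sub-slab bounds early, `∫₀ᵗ(T−s)^{−3/2} ≤ 2/√(T−t)`).
[folklore] -/
theorem fastSetBudget :
    ∀ c₀ : ℝ, 0 < c₀ →
    ∀ (ν T : ℝ), 0 < ν → 0 < T →
      ∀ (u : ℝ → EuclideanSpace ℝ (Fin 3) → EuclideanSpace ℝ (Fin 3))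
        (p : ℝ → EuclideanSpace ℝ (Fin 3) → ℝ),
      IsMaximalSmoothSolution ν 0 u p T → IsLerayHopfOn T ν 0 (u 0) u → HasRapidSpatialDecay (u 0) →
      IsTypeIBlowup u T →
      (∃ C : ℝ, ∀ᶠ t in nhdsWithin T (Set.Iio T), ∀ x, ‖curl (u t) x‖ ≤ C / (T - t)) →
      (∃ N : ℝ, ∀ s ∈ Set.Ico 0 T,
        volume {x : EuclideanSpace ℝ (Fin 3) | c₀ * Real.sqrt (ν / (T - s)) < ‖u s x‖} ≤
          ENNReal.ofReal (N * Real.sqrt (ν * (T - s)) ^ 3)) →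
      ∃ K : ℝ, ∀ t ∈ Set.Ico 0 T,
        (∫⁻ s in Set.Ioo 0 t, ∫⁻ x in {x : EuclideanSpace ℝ (Fin 3) | c₀ * Real.sqrt (ν / (T - s)) < ‖u s x‖},
          ‖cross (curl (u s) x) (u s x)‖ₑ ^ 2) ≤ ENNReal.ofReal (K / Real.sqrt (T - t)) := by
  intro c₀ _hc₀ ν T hν hT u p hmax hLH hdec hI hω hV
  obtain ⟨Cu, hCu⟩ := hI
  obtain ⟨Cω, hCω⟩ := hω
  obtain ⟨N, hN⟩ := hV
  have hsol : IsClassicalNSSolutionOn (Ico 0 T) ν 0 u p := hmax.1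
  -- ### the late window where both rate bounds hold
  obtain ⟨T₁, hT₁T, hT₁⟩ : ∃ T₁ < T, ∀ s ∈ Ioo T₁ T,
      (∀ x, ‖u s x‖ ≤ Cu / Real.sqrt (T - s)) ∧ (∀ x, ‖curl (u s) x‖ ≤ Cω / (T - s)) := by
    obtain ⟨T₁, hT₁, hsub⟩ := mem_nhdsLT_iff_exists_Ioo_subset.1 (hCu.and hCω)
    exact ⟨T₁, hT₁, fun s hs => hsub hs⟩
  set S : ℝ := max T₁ (T / 2) with hS
  have hS0 : 0 < S := lt_of_lt_of_le (by linarith) (le_max_right _ _)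
  have hST : S < T := max_lt hT₁T (by linarith)
  have hlate : ∀ s ∈ Ioo S T,
      (∀ x, ‖u s x‖ ≤ Cu / Real.sqrt (T - s)) ∧ (∀ x, ‖curl (u s) x‖ ≤ Cω / (T - s)) :=
    fun s hs => hT₁ s ⟨lt_of_le_of_lt (le_max_left _ _) hs.1, hs.2⟩
  -- ### early bounds on the closed sub-slab `[0, S]` (Tao's class)
  have hcl' : IsClassicalNSSolutionOn (Icc 0 S) ν 0 u p :=
    hsol.mono (Icc_subset_Ico_right hST) (uniqueDiffOn_Icc hS0)
  have hEn : ∃ C : ℝ≥0∞, C < ⊤ ∧ ∀ t ∈ Icc 0 S, ∫⁻ x, ‖u t x‖ₑ ^ 2 ≤ C :=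
    ⟨ENNReal.ofReal (2 * VectorCalculus.kineticEnergy (u 0)), ENNReal.ofReal_lt_top, fun t ht =>
      hLH.lintegral_enorm_sq_le hν.le ⟨ht.1, ht.2.trans hST.le⟩⟩
  have hH : HasBoundedSobolevNormsOn (Icc 0 S) u :=
    (tao2011_hasBoundedSobolevNormsOn.closedSlab tao2011_hasBoundedSobolevNormsOn_holds
      linfty_bound_of_hasBoundedSobolevNormsOn_holds ν S hν hS0 u p hcl' hEn hdec).1
  obtain ⟨V, hVb⟩ := linfty_bound_of_hasBoundedSobolevNormsOn_holds
    (fun t ht => (hcl'.contDiff_velocity ht).of_le (by norm_cast)) hH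
  obtain ⟨C₁, hC₁⟩ := hH 1
  set κ : ℝ := ‖(Literature.Analysis.FluidPDE.curlCLM :
    (EuclideanSpace ℝ (Fin 3) →L[ℝ] EuclideanSpace ℝ (Fin 3)) →L[ℝ] EuclideanSpace ℝ (Fin 3))‖ with hκ
  have hκ0 : 0 ≤ κ := by
    rw [hκ]
    exact norm_nonneg (Literature.Analysis.FluidPDE.curlCLM :
      (EuclideanSpace ℝ (Fin 3) →L[ℝ] EuclideanSpace ℝ (Fin 3)) →L[ℝ] EuclideanSpace ℝ (Fin 3))
  have hZ : ∀ s ∈ Icc 0 S, ∫⁻ x, ‖curl (u s) x‖ₑ ^ 2 ≤ ENNReal.ofReal (κ ^ 2) * C₁ := by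
    intro s hs
    have hpt : ∀ x, ‖curl (u s) x‖ₑ ^ 2 ≤
        ENNReal.ofReal (κ ^ 2) * ‖iteratedFDeriv ℝ 1 (u s) x‖ₑ ^ 2 := by
      intro x
      have h1 : ‖curl (u s) x‖ ≤ κ * ‖iteratedFDeriv ℝ 1 (u s) x‖ := by
        have e : ‖fderiv ℝ (u s) x‖ = ‖iteratedFDeriv ℝ 1 (u s) x‖ := by
          rw [← norm_iteratedFDeriv_zero (𝕜 := ℝ) (f := fderiv ℝ (u s)), norm_iteratedFDeriv_fderiv]
        rw [← e]
        exact norm_curl_le (u s) x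
      calc ‖curl (u s) x‖ₑ ^ 2 = ENNReal.ofReal ‖curl (u s) x‖ ^ 2 := by rw [ofReal_norm]
        _ ≤ ENNReal.ofReal (κ * ‖iteratedFDeriv ℝ 1 (u s) x‖) ^ 2 := by gcongr
        _ = ENNReal.ofReal (κ ^ 2) * ‖iteratedFDeriv ℝ 1 (u s) x‖ₑ ^ 2 := by
            rw [ENNReal.ofReal_mul hκ0, ofReal_norm, mul_pow, ← ENNReal.ofReal_pow hκ0]
    calc ∫⁻ x, ‖curl (u s) x‖ₑ ^ 2
        ≤ ∫⁻ x, ENNReal.ofReal (κ ^ 2) * ‖iteratedFDeriv ℝ 1 (u s) x‖ₑ ^ 2 := lintegral_mono hpt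
      _ = ENNReal.ofReal (κ ^ 2) * ∫⁻ x, ‖iteratedFDeriv ℝ 1 (u s) x‖ₑ ^ 2 :=
          lintegral_const_mul' _ _ ENNReal.ofReal_ne_top
      _ ≤ ENNReal.ofReal (κ ^ 2) * C₁ := mul_le_mul' le_rfl (hC₁ s hs)
  have hV0 : 0 ≤ V := (norm_nonneg (u 0 0)).trans (hVb 0 ⟨le_rfl, hS0.le⟩ 0)
  -- ### constants
  set E₁ : ℝ := κ ^ 2 * (C₁ : ℝ) * V ^ 2 with hE₁
  have hE₁0 : 0 ≤ E₁ := by positivity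
  have hE₁e : ENNReal.ofReal (κ ^ 2) * C₁ * ENNReal.ofReal (V ^ 2) = ENNReal.ofReal E₁ := by
    rw [hE₁, ← ENNReal.ofReal_coe_nnreal, ← ENNReal.ofReal_mul (sq_nonneg _),
      ← ENNReal.ofReal_mul (by positivity)]
  set N' : ℝ := max N 0 with hN'
  have hN'0 : 0 ≤ N' := le_max_right _ _
  set A : ℝ := N' * Real.sqrt ν ^ 3 * Cω ^ 2 * Cu ^ 2 with hA
  have hA0 : 0 ≤ A := by positivity
  refine ⟨E₁ * T * Real.sqrt T + 2 * A, fun t ht => ?_⟩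
  -- ### the integrand bound on `(0, t)`
  have hinner : ∀ s ∈ Ioo 0 t,
      (∫⁻ x in {x : EuclideanSpace ℝ (Fin 3) | c₀ * Real.sqrt (ν / (T - s)) < ‖u s x‖},
        ‖cross (curl (u s) x) (u s x)‖ₑ ^ 2) ≤
        ENNReal.ofReal (E₁ + A * (Real.sqrt (T - s))⁻¹ ^ 3) := by
    intro s hs
    have hsT : s < T := hs.2.trans ht.2
    have hTs : 0 < T - s := sub_pos.2 hsT
    by_cases hsS : s ≤ S
    · -- early: `∫_F |ω×u|² ≤ V² ∫ |ω|² ≤ V² κ² C₁ = E₁`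
      have hsI : s ∈ Icc 0 S := ⟨hs.1.le, hsS⟩
      calc (∫⁻ x in {x : EuclideanSpace ℝ (Fin 3) | c₀ * Real.sqrt (ν / (T - s)) < ‖u s x‖},
            ‖cross (curl (u s) x) (u s x)‖ₑ ^ 2)
          ≤ ∫⁻ x in {x : EuclideanSpace ℝ (Fin 3) | c₀ * Real.sqrt (ν / (T - s)) < ‖u s x‖},
              ‖curl (u s) x‖ₑ ^ 2 * ENNReal.ofReal (V ^ 2) :=
            lintegral_mono fun x => (enorm_cross_sq_le _ _).trans
              (mul_le_mul' le_rfl (enorm_sq_le_ofReal_sq (hVb s hsI x)))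
        _ ≤ ∫⁻ x, ‖curl (u s) x‖ₑ ^ 2 * ENNReal.ofReal (V ^ 2) := setLIntegral_le_lintegral _ _
        _ = (∫⁻ x, ‖curl (u s) x‖ₑ ^ 2) * ENNReal.ofReal (V ^ 2) :=
            lintegral_mul_const' _ _ ENNReal.ofReal_ne_top
        _ ≤ ENNReal.ofReal (κ ^ 2) * C₁ * ENNReal.ofReal (V ^ 2) := mul_le_mul' (hZ s hsI) le_rfl
        _ = ENNReal.ofReal E₁ := hE₁e
        _ ≤ ENNReal.ofReal (E₁ + A * (Real.sqrt (T - s))⁻¹ ^ 3) :=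
            ENNReal.ofReal_le_ofReal (le_add_of_nonneg_right (by positivity))
    · -- late: measure × sup
      obtain ⟨hu_s, hω_s⟩ := hlate s ⟨not_le.1 hsS, hsT⟩
      set b : ℝ := Real.sqrt (T - s) with hb
      have hbpos : 0 < b := Real.sqrt_pos.2 hTs
      have hb2 : b ^ 2 = T - s := Real.sq_sqrt hTs.le
      have hω' : ∀ x, ‖curl (u s) x‖ ≤ Cω / b ^ 2 := fun x => by rw [hb2]; exact hω_s x
      set cst : ℝ≥0∞ := ENNReal.ofReal ((Cω / b ^ 2) ^ 2) * ENNReal.ofReal ((Cu / b) ^ 2) with hcst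
      have hvol : volume {x : EuclideanSpace ℝ (Fin 3) | c₀ * Real.sqrt (ν / (T - s)) < ‖u s x‖} ≤
          ENNReal.ofReal (N' * (Real.sqrt ν * b) ^ 3) := by
        refine (hN s ⟨hs.1.le, hsT⟩).trans (ENNReal.ofReal_le_ofReal ?_)
        rw [Real.sqrt_mul hν.le, ← hb]
        exact mul_le_mul_of_nonneg_right (le_max_left _ _) (by positivity)
      calc (∫⁻ x in {x : EuclideanSpace ℝ (Fin 3) | c₀ * Real.sqrt (ν / (T - s)) < ‖u s x‖},
            ‖cross (curl (u s) x) (u s x)‖ₑ ^ 2)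
          ≤ ∫⁻ _ in {x : EuclideanSpace ℝ (Fin 3) | c₀ * Real.sqrt (ν / (T - s)) < ‖u s x‖}, cst :=
            lintegral_mono fun x => (enorm_cross_sq_le _ _).trans
              (mul_le_mul' (enorm_sq_le_ofReal_sq (hω' x)) (enorm_sq_le_ofReal_sq (hu_s x)))
        _ = cst * volume {x : EuclideanSpace ℝ (Fin 3) | c₀ * Real.sqrt (ν / (T - s)) < ‖u s x‖} :=
            setLIntegral_const _ _
        _ ≤ cst * ENNReal.ofReal (N' * (Real.sqrt ν * b) ^ 3) := mul_le_mul' le_rfl hvol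
        _ = ENNReal.ofReal (A * b⁻¹ ^ 3) := by
            rw [hcst, ← ENNReal.ofReal_mul (sq_nonneg _), ← ENNReal.ofReal_mul (by positivity)]
            congr 1
            rw [hA]
            field_simp
        _ ≤ ENNReal.ofReal (E₁ + A * (Real.sqrt (T - s))⁻¹ ^ 3) :=
            ENNReal.ofReal_le_ofReal (le_add_of_nonneg_left hE₁0)
  -- ### integrate in time
  have ht0 : 0 ≤ t := ht.1
  have htT : t < T := ht.2
  have hTt : 0 < T - t := sub_pos.2 htT
  calc (∫⁻ s in Ioo 0 t, ∫⁻ x in {x : EuclideanSpace ℝ (Fin 3) | c₀ * Real.sqrt (ν / (T - s)) < ‖u s x‖},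
        ‖cross (curl (u s) x) (u s x)‖ₑ ^ 2)
      ≤ ∫⁻ s in Ioo 0 t, ENNReal.ofReal (E₁ + A * (Real.sqrt (T - s))⁻¹ ^ 3) :=
        setLIntegral_mono_ae' measurableSet_Ioo (ae_of_all _ hinner)
    _ = ∫⁻ s in Ioo 0 t, (ENNReal.ofReal E₁ +
          ENNReal.ofReal A * ENNReal.ofReal ((Real.sqrt (T - s))⁻¹ ^ 3)) := by
        refine lintegral_congr fun s => ?_
        rw [ENNReal.ofReal_add hE₁0 (by positivity), ENNReal.ofReal_mul hA0]
    _ = ENNReal.ofReal E₁ * volume (Ioo (0 : ℝ) t) +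
          ENNReal.ofReal A * ∫⁻ s in Ioo 0 t, ENNReal.ofReal ((Real.sqrt (T - s))⁻¹ ^ 3) := by
        rw [lintegral_add_left measurable_const, setLIntegral_const,
          lintegral_const_mul' _ _ ENNReal.ofReal_ne_top]
    _ ≤ ENNReal.ofReal E₁ * ENNReal.ofReal T + ENNReal.ofReal A * ENNReal.ofReal (2 / Real.sqrt (T - t)) := by
        gcongr
        · rw [Real.volume_Ioo]
          exact ENNReal.ofReal_le_ofReal (by linarith)
        · exact lintegral_Ioo_inv_sqrt_cube_le ht0 htT
    _ = ENNReal.ofReal (E₁ * T + 2 * A / Real.sqrt (T - t)) := by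
        rw [← ENNReal.ofReal_mul hE₁0, ← ENNReal.ofReal_mul hA0, ← ENNReal.ofReal_add (by positivity)
          (by positivity)]
        congr 1
        ring
    _ ≤ ENNReal.ofReal ((E₁ * T * Real.sqrt T + 2 * A) / Real.sqrt (T - t)) := by
        refine ENNReal.ofReal_le_ofReal ?_
        have hsT : 0 < Real.sqrt (T - t) := Real.sqrt_pos.2 hTt
        have hsTT : Real.sqrt (T - t) ≤ Real.sqrt T := Real.sqrt_le_sqrt (by linarith)
        have h1 : E₁ * T ≤ E₁ * T * Real.sqrt T / Real.sqrt (T - t) := by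
          have h2 : 1 ≤ Real.sqrt T / Real.sqrt (T - t) := by rw [le_div_iff₀ hsT]; linarith
          have hE : 0 ≤ E₁ * T := by positivity
          calc E₁ * T = E₁ * T * 1 := (mul_one _).symm
            _ ≤ E₁ * T * (Real.sqrt T / Real.sqrt (T - t)) := mul_le_mul_of_nonneg_left h2 hE
            _ = E₁ * T * Real.sqrt T / Real.sqrt (T - t) := by ring
        have h3 : (E₁ * T * Real.sqrt T + 2 * A) / Real.sqrt (T - t) =
            E₁ * T * Real.sqrt T / Real.sqrt (T - t) + 2 * A / Real.sqrt (T - t) := by ring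
        rw [h3]
        linarith

end Summit.NavierStokesRegularity.NavierStokesRegularity.Theorems.EnstrophyQuarterLaw.LambBudget

end
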